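import Mathlib
import Summits.NavierStokesRegularity.NavierStokesRegularity.Theorems.ThreadingFluxSilentShellsJiuXinLiouville
import HarnessLib

/-!
# Crux `PoloidalLiouville` (stmt-NavierStokesRegularity-1222, W1), crux idea «silent-shells»:
# towards the PRINTED Jiu–Xin Liouville theorem (Thm 5.3) — the slab test field

First of four files proving the printed Jiu–Xin theorem [JiuXin2008, Thm 5.3] (finite energy, `u → 0`, `p → p₀` at
infinity; NO compact support) in the kernel, target `SilentShells.jiuXin2008_thm53` (silent-shells sketch v1.4 l.279, by
name).  The compact-support proof (`ThreadingFluxSilentShellsJiuXinLiouville`) tested the Euler pair against the GLOBAL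
field `G_ε = x_h/(ρ²+ε²)`; without compact support of `U` one tests against the COMPACTLY SUPPORTED slab field
`G = χ_R(x) η_Z(x₂)² G_ε(x)` (`χ_R` the radial cut-off of `…JiuXinAxis`, `η_Z` a vertical cut-off) and lets `R → ∞`,
`ε → 0⁺`, `Z → ∞` in this order.  Here:

* `JiuXin.virial_identity_test` — `∫⟪U, DG[U]⟫ = −∫(P − p₀) div G` for EVERY compactly supported `C¹` field `G`, the
  Euler pair `(U, P)` being merely `C¹` (no support, no decay);
* `sup |smoothTransition′|` (`exists_deriv_smoothTransition_bound`) and the size of the cut-off gradients: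
  `|c_R| ≤ (2S/3)/R²`, `|d_Z| ≤ (4S/3)/Z` where `Dχ_R(x) v = c_R(x)⟪x,v⟫`, `Dη_Z(x) v = d_Z(x) v₂`;
* the vertical cut-off `JiuXin.vertCut Z` (`= 1` for `|x₂| ≤ Z`, `= 0` for `|x₂| ≥ 2Z`, monotone in `Z`);
* the slab weight `w = χ_R η_Z²` and slab field `w • G_ε`: derivative, `⟪U, D(wG_ε)[U]⟫ = w⟪U,DG_ε U⟫ + Dw[U]⟪U,G_ε⟫`,
  `div (w G_ε) = w k_ε + η_Z² c_R ρ²/(ρ²+ε²)` (the vertical derivative drops out: `G_ε ⊥ e₂`).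

All `--supports stmt-NavierStokesRegularity-1222 --as helper`; W1 movement 0; NS regularity is NOT proved by any of this.
-/

-- the summit and its single problem share the name (D-0017 nested layout)
set_option linter.dupNamespace false

noncomputable section

namespace Summit.NavierStokesRegularity.NavierStokesRegularity.Theorems.PoloidalLiouville.SilentShells

open Set Function Filter MeasureTheory Topology Metric
open scoped Topology RealInnerProductSpace
open Literature.Analysis.FluidPDE
open Summit.NavierStokesRegularity.NavierStokesRegularity.Theorems.PoloidalLiouville.HorizonTower (E3)

namespace JiuXin

/-! ## The virial identity against compactly supported test fields -/

section Euler

variable {U : E3 → E3} {P : E3 → ℝ}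

/-- **Virial identity, test-field form.** For a `C¹` steady Euler pair `(U, P)` with `div U = 0` (no support or decay
assumption) and every compactly supported `C¹` field `G`: `∫⟪U, DG[U]⟫ = −∫(P − p₀) div G` for any constant `p₀`
(test `θ = ⟪U,G⟫ ∈ C¹_c` against the divergence-free `U`, Euler, then `∫(P − p₀) div G = −∫⟪G, ∇P⟫`).
[cite: JiuXin2008, (3.22)–(3.24)] -/
theorem virial_identity_test (hU : ContDiff ℝ 1 U) (hP : ContDiff ℝ 1 P) (hdiv : VectorCalculus.IsDivFree U)
    (hE : ∀ x, convect U U x + gradient P x = 0) {G : E3 → E3} (hG : ContDiff ℝ 1 G) (hGc : HasCompactSupport G)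
    (p₀ : ℝ) :
    ∫ x, ⟪U x, fderiv ℝ G x (U x)⟫ = -∫ x, (P x - p₀) * VectorCalculus.divergence G x := by
  have hθ : ContDiff ℝ 1 fun x => ⟪U x, G x⟫ := hU.inner ℝ hG
  have hθc : HasCompactSupport fun x => ⟪U x, G x⟫ :=
    hGc.mono fun x hx => by contrapose! hx; simp_all
  have h1 := integral_mul_divergence_add_eq_zero_left hθ hU hθc
  have hz : ∫ x, ⟪U x, G x⟫ * VectorCalculus.divergence U x = 0 := by simp [hdiv _]
  rw [hz, zero_add] at h1
  have hUd : ∀ x, DifferentiableAt ℝ U x := fun x => hU.differentiable one_ne_zero x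
  have hGd : ∀ x, DifferentiableAt ℝ G x := fun x => hG.differentiable one_ne_zero x
  have hgrad : ∀ x, ⟪U x, gradient (fun y => ⟪U y, G y⟫) x⟫ =
      ⟪U x, fderiv ℝ G x (U x)⟫ - ⟪gradient P x, G x⟫ := by
    intro x
    rw [gradient, real_inner_comm, InnerProductSpace.toDual_symm_apply, fderiv_inner_apply ℝ (hUd x) (hGd x)]
    have hconv : fderiv ℝ U x (U x) = -gradient P x := by
      have := hE x; rw [convect_apply] at this; exact eq_neg_of_add_eq_zero_left this
    simp [hconv, inner_neg_left, sub_eq_add_neg]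
  simp_rw [hgrad] at h1
  have hGdc : HasCompactSupport (fderiv ℝ G) := hGc.fderiv (𝕜 := ℝ)
  have hi₁ : Integrable (fun x => ⟪U x, fderiv ℝ G x (U x)⟫) (volume : Measure E3) := by
    refine (hU.continuous.inner ((hG.continuous_fderiv one_ne_zero).clm_apply hU.continuous))
      |>.integrable_of_hasCompactSupport (hGdc.mono fun x hx => ?_)
    rw [Function.mem_support] at hx ⊢
    contrapose! hx
    simp [hx]
  have hi₂ : Integrable (fun x => ⟪gradient P x, G x⟫) (volume : Measure E3) :=
    ((continuous_gradient_of_contDiff hP).inner hG.continuous).integrable_of_hasCompactSupport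
      (hGc.mono fun x hx => by
        rw [Function.mem_support] at hx ⊢
        contrapose! hx
        simp [hx])
  rw [integral_sub hi₁ hi₂, sub_eq_zero] at h1
  have h2 := integral_mul_divergence_add_eq_zero_right (θ := fun x => P x - p₀) (hP.sub contDiff_const) hG hGc
  have hgradP : ∀ x, gradient (fun y => P y - p₀) x = gradient P x := fun x => by
    simp [gradient, fderiv_sub_const]
  have h2' : ∫ x, ⟪gradient P x, G x⟫ = -∫ x, (P x - p₀) * VectorCalculus.divergence G x := by
    have : ∫ x, ⟪G x, gradient (fun y => P y - p₀) x⟫ = ∫ x, ⟪gradient P x, G x⟫ :=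
      integral_congr_ae (Eventually.of_forall fun x => by beta_reduce; rw [hgradP x, real_inner_comm])
    linarith
  rw [h1, h2']

end Euler

/-! ## `sup |smoothTransition′|` and the size of the cut-off gradients -/

/-! (`smoothTransition′ = 0` above `1` is `Literature.Geometry.Lorentzian.deriv_smoothTransition_eq_zero_of_one_lt`
in the tree; the three-line argument is inlined below to keep this file's imports inside fluid mechanics.) -/

/-- `smoothTransition′` is bounded: `|smoothTransition′ t| ≤ S` for some `S ≥ 0` (continuous, vanishing off `[0,1]`). -/
theorem exists_deriv_smoothTransition_bound : ∃ S : ℝ, 0 ≤ S ∧ ∀ t, |deriv Real.smoothTransition t| ≤ S := by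
  have hc : Continuous (deriv Real.smoothTransition) :=
    (Real.smoothTransition.contDiff (n := 1)).continuous_deriv le_rfl
  have hs : HasCompactSupport (deriv Real.smoothTransition) := by
    refine HasCompactSupport.intro (isCompact_Icc (a := (0 : ℝ)) (b := 1)) fun t ht => ?_
    rw [mem_Icc, not_and_or, not_le, not_le] at ht
    rcases ht with ht | ht
    · exact deriv_smoothTransition_eq_zero_of_neg ht
    · have hev : Real.smoothTransition =ᶠ[𝓝 t] fun _ => (1 : ℝ) := by
        filter_upwards [Ioi_mem_nhds ht] with z hz using Real.smoothTransition.one_of_one_le hz.le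
      rw [hev.deriv_eq, deriv_const]
  obtain ⟨S, hS⟩ := hc.bounded_above_of_compact_support hs
  exact ⟨max S 0, le_max_right _ _, fun t => (Real.norm_eq_abs _ ▸ hS t).trans (le_max_left _ _)⟩

/-- Size of the radial cut-off gradient: `|c_R(x)| ≤ (2S/3)/R²`. -/
theorem abs_cutoffCoeff_le {S : ℝ} (hS : ∀ t, |deriv Real.smoothTransition t| ≤ S) (R : ℝ) (x : E3) :
    |cutoffCoeff R x| ≤ 2 * S / (3 * R ^ 2) := by
  unfold cutoffCoeff
  rw [abs_mul]
  have h1 := hS ((4 * R ^ 2 - ‖x‖ ^ 2) * (3 * R ^ 2)⁻¹)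
  have h2 : |(-(2 * (3 * R ^ 2)⁻¹) : ℝ)| = 2 * (3 * R ^ 2)⁻¹ := by
    rw [abs_neg, abs_of_nonneg (by positivity)]
  rw [h2]
  calc |deriv Real.smoothTransition ((4 * R ^ 2 - ‖x‖ ^ 2) * (3 * R ^ 2)⁻¹)| * (2 * (3 * R ^ 2)⁻¹)
      ≤ S * (2 * (3 * R ^ 2)⁻¹) := mul_le_mul_of_nonneg_right h1 (by positivity)
    _ = 2 * S / (3 * R ^ 2) := by ring

/-- `c_R(x) = 0` inside the ball `B(0,R)` (`χ_R ≡ 1` there). -/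
theorem cutoffCoeff_eq_zero_of_norm_lt {R : ℝ} (hR : 0 < R) {x : E3} (hx : ‖x‖ < R) : cutoffCoeff R x = 0 := by
  have hx2 : ‖x‖ ^ 2 < R ^ 2 := pow_lt_pow_left₀ hx (norm_nonneg x) two_ne_zero
  have hgt : 1 < (4 * R ^ 2 - ‖x‖ ^ 2) * (3 * R ^ 2)⁻¹ := by
    rw [← div_eq_mul_inv, lt_div_iff₀ (by positivity)]; linarith
  have hev : Real.smoothTransition =ᶠ[𝓝 ((4 * R ^ 2 - ‖x‖ ^ 2) * (3 * R ^ 2)⁻¹)] fun _ => (1 : ℝ) := by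
    filter_upwards [Ioi_mem_nhds hgt] with z hz using Real.smoothTransition.one_of_one_le hz.le
  rw [cutoffCoeff, hev.deriv_eq, deriv_const, zero_mul]

/-- `c_R(x) = 0` off the ball `B̄(0,2R)`. -/
theorem cutoffCoeff_eq_zero_of_lt_norm {R : ℝ} (hR : 0 < R) {x : E3} (hx : 2 * R < ‖x‖) : cutoffCoeff R x = 0 := by
  have hx2 : (2 * R) ^ 2 < ‖x‖ ^ 2 := pow_lt_pow_left₀ hx (by positivity) two_ne_zero
  have hneg : (4 * R ^ 2 - ‖x‖ ^ 2) * (3 * R ^ 2)⁻¹ < 0 := by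
    rw [← div_eq_mul_inv]; exact div_neg_of_neg_of_pos (by nlinarith) (by positivity)
  rw [cutoffCoeff, deriv_smoothTransition_eq_zero_of_neg hneg, zero_mul]

/-- `|c_R(x) ⟪x, v⟫| ≤ (4S/3)/R · ‖v‖` (the gradient of `χ_R` is `O(1/R)`, supported in `‖x‖ ≤ 2R`). -/
theorem abs_cutoffCoeff_mul_inner_le {S : ℝ} (hS0 : 0 ≤ S) (hS : ∀ t, |deriv Real.smoothTransition t| ≤ S) {R : ℝ}
    (hR : 0 < R) (x v : E3) : |cutoffCoeff R x * ⟪x, v⟫| ≤ 4 * S / (3 * R) * ‖v‖ := by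
  by_cases hx : 2 * R < ‖x‖
  · rw [cutoffCoeff_eq_zero_of_lt_norm hR hx, zero_mul, abs_zero]; positivity
  · rw [not_lt] at hx
    rw [abs_mul]
    calc |cutoffCoeff R x| * |⟪x, v⟫| ≤ (2 * S / (3 * R ^ 2)) * (‖x‖ * ‖v‖) :=
          mul_le_mul (abs_cutoffCoeff_le hS R x) (abs_real_inner_le_norm _ _) (abs_nonneg _) (by positivity)
      _ ≤ (2 * S / (3 * R ^ 2)) * (2 * R * ‖v‖) := by gcongr
      _ = 4 * S / (3 * R) * ‖v‖ := by field_simp; ring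

/-! ## The vertical cut-off `η_Z` -/

/-- The vertical cut-off `η_Z(x) = smoothTransition((4Z² − x₂²)/(3Z²))`: `= 1` for `|x₂| ≤ Z`, `= 0` for `|x₂| ≥ 2Z`. -/
def vertCut (Z : ℝ) (x : E3) : ℝ := Real.smoothTransition ((4 * Z ^ 2 - (x 2) ^ 2) * (3 * Z ^ 2)⁻¹)

/-- The coefficient of `∂₂η_Z`: `Dη_Z(x) v = d_Z(x) v₂`. -/
def vertCutCoeff (Z : ℝ) (x : E3) : ℝ :=
  deriv Real.smoothTransition ((4 * Z ^ 2 - (x 2) ^ 2) * (3 * Z ^ 2)⁻¹) * (-(2 * (3 * Z ^ 2)⁻¹)) * x 2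

/-- `η_Z ≥ 0`. -/
theorem vertCut_nonneg (Z : ℝ) (x : E3) : 0 ≤ vertCut Z x := Real.smoothTransition.nonneg _

/-- `η_Z ≤ 1`. -/
theorem vertCut_le_one (Z : ℝ) (x : E3) : vertCut Z x ≤ 1 := Real.smoothTransition.le_one _

/-- `η_Z = 1` on the slab `|x₂| ≤ Z`. -/
theorem vertCut_eq_one {Z : ℝ} (hZ : 0 < Z) {x : E3} (hx : |x 2| ≤ Z) : vertCut Z x = 1 := by
  refine Real.smoothTransition.one_of_one_le ?_
  rw [← div_eq_mul_inv, le_div_iff₀ (by positivity)]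
  have : (x 2) ^ 2 ≤ Z ^ 2 := by rw [← sq_abs]; exact pow_le_pow_left₀ (abs_nonneg _) hx 2
  linarith

/-- `η_Z = 0` off the slab `|x₂| < 2Z`. -/
theorem vertCut_eq_zero {Z : ℝ} (hZ : 0 < Z) {x : E3} (hx : 2 * Z ≤ |x 2|) : vertCut Z x = 0 := by
  refine Real.smoothTransition.zero_of_nonpos ?_
  rw [← div_eq_mul_inv]
  apply div_nonpos_of_nonpos_of_nonneg _ (by positivity)
  have : (2 * Z) ^ 2 ≤ (x 2) ^ 2 := by rw [← sq_abs (x 2)]; exact pow_le_pow_left₀ (by positivity) hx 2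
  linarith

/-- If `η_Z(x) ≠ 0` then `|x₂| < 2Z`. -/
theorem abs_lt_of_vertCut_ne_zero {Z : ℝ} (hZ : 0 < Z) {x : E3} (hx : vertCut Z x ≠ 0) : |x 2| < 2 * Z := by
  by_contra h
  exact hx (vertCut_eq_zero hZ (not_lt.mp h))

/-- `η_Z` is smooth. -/
theorem contDiff_vertCut {n : ℕ∞} (Z : ℝ) : ContDiff ℝ n (vertCut Z) := by
  unfold vertCut
  have h2 : ContDiff ℝ n fun y : E3 => (y 2) ^ 2 :=
    (EuclideanSpace.proj (2 : Fin 3) : E3 →L[ℝ] ℝ).contDiff.pow 2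
  exact (Real.smoothTransition.contDiff (n := n)).comp ((contDiff_const.sub h2).mul contDiff_const)

/-- `Dη_Z(x) = d_Z(x) · pr₂`. -/
theorem hasFDerivAt_vertCut (Z : ℝ) (x : E3) :
    HasFDerivAt (vertCut Z) (vertCutCoeff Z x • (EuclideanSpace.proj (2 : Fin 3) : E3 →L[ℝ] ℝ)) x := by
  have h0 : HasFDerivAt (fun y : E3 => (y 2) ^ 2)
      ((2 * x 2) • (EuclideanSpace.proj (2 : Fin 3) : E3 →L[ℝ] ℝ)) x := by
    have := ((EuclideanSpace.proj (2 : Fin 3) : E3 →L[ℝ] ℝ).hasFDerivAt (x := x)).pow 2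
    simpa using this
  have h1 := (h0.const_sub (4 * Z ^ 2)).mul_const ((3 * Z ^ 2)⁻¹)
  have h2 : HasDerivAt Real.smoothTransition
      (deriv Real.smoothTransition ((4 * Z ^ 2 - (x 2) ^ 2) * (3 * Z ^ 2)⁻¹))
      ((4 * Z ^ 2 - (x 2) ^ 2) * (3 * Z ^ 2)⁻¹) :=
    ((Real.smoothTransition.contDiff (n := 1)).differentiable one_ne_zero _).hasDerivAt
  have h3 : HasFDerivAt (vertCut Z) (deriv Real.smoothTransition ((4 * Z ^ 2 - (x 2) ^ 2) * (3 * Z ^ 2)⁻¹) •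
      ((3 * Z ^ 2)⁻¹ • -((2 * x 2) • (EuclideanSpace.proj (2 : Fin 3) : E3 →L[ℝ] ℝ)))) x :=
    h2.comp_hasFDerivAt x h1
  refine h3.congr_fderiv ?_
  ext v
  simp [vertCutCoeff]
  ring

/-- `Dη_Z(x) v = d_Z(x) v₂`. -/
theorem fderiv_vertCut_apply (Z : ℝ) (x v : E3) : fderiv ℝ (vertCut Z) x v = vertCutCoeff Z x * v 2 := by
  rw [(hasFDerivAt_vertCut Z x).fderiv]; simp

/-- Size of the vertical cut-off gradient: `|d_Z(x)| ≤ (4S/3)/Z`. -/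
theorem abs_vertCutCoeff_le {S : ℝ} (hS0 : 0 ≤ S) (hS : ∀ t, |deriv Real.smoothTransition t| ≤ S) {Z : ℝ}
    (hZ : 0 < Z) (x : E3) : |vertCutCoeff Z x| ≤ 4 * S / (3 * Z) := by
  by_cases hx : 2 * Z < |x 2|
  · have hx2 : (2 * Z) ^ 2 < (x 2) ^ 2 := by
      rw [← sq_abs (x 2)]; exact pow_lt_pow_left₀ hx (by positivity) two_ne_zero
    have hneg : (4 * Z ^ 2 - (x 2) ^ 2) * (3 * Z ^ 2)⁻¹ < 0 := by
      rw [← div_eq_mul_inv]; exact div_neg_of_neg_of_pos (by nlinarith) (by positivity)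
    rw [vertCutCoeff, deriv_smoothTransition_eq_zero_of_neg hneg, zero_mul, zero_mul, abs_zero]
    positivity
  · rw [not_lt] at hx
    unfold vertCutCoeff
    rw [abs_mul, abs_mul]
    have h1 := hS ((4 * Z ^ 2 - (x 2) ^ 2) * (3 * Z ^ 2)⁻¹)
    have h2 : |(-(2 * (3 * Z ^ 2)⁻¹) : ℝ)| = 2 * (3 * Z ^ 2)⁻¹ := by
      rw [abs_neg, abs_of_nonneg (by positivity)]
    rw [h2]
    calc |deriv Real.smoothTransition ((4 * Z ^ 2 - (x 2) ^ 2) * (3 * Z ^ 2)⁻¹)| * (2 * (3 * Z ^ 2)⁻¹) * |x 2|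
        ≤ S * (2 * (3 * Z ^ 2)⁻¹) * (2 * Z) := by gcongr
      _ = 4 * S / (3 * Z) := by field_simp; ring

/-- `η_Z` is monotone in `Z`: `Z ≤ Z'` ⇒ `η_Z ≤ η_{Z'}` (for `Z > 0`). -/
theorem vertCut_mono {Z Z' : ℝ} (hZ : 0 < Z) (hZZ' : Z ≤ Z') (x : E3) : vertCut Z x ≤ vertCut Z' x := by
  unfold vertCut
  refine Real.smoothTransition.monotone ?_
  have hZ' : 0 < Z' := hZ.trans_le hZZ'
  rw [← div_eq_mul_inv, ← div_eq_mul_inv, div_le_div_iff₀ (by positivity) (by positivity)]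
  have h1 : Z ^ 2 ≤ Z' ^ 2 := pow_le_pow_left₀ hZ.le hZZ' 2
  nlinarith [sq_nonneg (x 2)]

/-! ## The slab weight `w = χ_R η_Z²` and the slab field `w • G_ε` -/

/-- The slab weight `w(x) = χ_R(x) η_Z(x)²`. -/
def slabWeight (R Z : ℝ) (x : E3) : ℝ := cutoff R x * vertCut Z x ^ 2

/-- The derivative of the slab weight as a scalar: `Dw(x) v = η_Z² c_R ⟪x,v⟫ + χ_R · 2η_Z d_Z v₂`. -/
def slabWeightDeriv (R Z : ℝ) (x v : E3) : ℝ :=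
  vertCut Z x ^ 2 * (cutoffCoeff R x * ⟪x, v⟫) + cutoff R x * (2 * vertCut Z x * (vertCutCoeff Z x * v 2))

/-- The derivative of the slab weight as a continuous linear map. -/
def slabWeight' (R Z : ℝ) (x : E3) : E3 →L[ℝ] ℝ :=
  cutoff R x • ((2 * vertCut Z x) • (vertCutCoeff Z x • (EuclideanSpace.proj (2 : Fin 3) : E3 →L[ℝ] ℝ))) +
    vertCut Z x ^ 2 • (cutoffCoeff R x • innerSL ℝ x)

/-- `slabWeight'` evaluated is `slabWeightDeriv`. -/
theorem slabWeight'_apply (R Z : ℝ) (x v : E3) : slabWeight' R Z x v = slabWeightDeriv R Z x v := by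
  simp [slabWeight', slabWeightDeriv]
  ring

/-- `0 ≤ w ≤ 1`. -/
theorem slabWeight_nonneg (R Z : ℝ) (x : E3) : 0 ≤ slabWeight R Z x :=
  mul_nonneg (cutoff_nonneg R x) (sq_nonneg _)

/-- `w ≤ 1`. -/
theorem slabWeight_le_one (R Z : ℝ) (x : E3) : slabWeight R Z x ≤ 1 := by
  unfold slabWeight
  have h1 := cutoff_le_one R x
  have h2 : vertCut Z x ^ 2 ≤ 1 := pow_le_one₀ (vertCut_nonneg Z x) (vertCut_le_one Z x)
  calc cutoff R x * vertCut Z x ^ 2 ≤ 1 * 1 := mul_le_mul h1 h2 (sq_nonneg _) zero_le_one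
    _ = 1 := mul_one _

/-- `w` is `C¹` (indeed smooth). -/
theorem contDiff_slabWeight {n : ℕ∞} (R Z : ℝ) : ContDiff ℝ n (slabWeight R Z) :=
  (contDiff_cutoff R).mul ((contDiff_vertCut Z).pow 2)

/-- The derivative of `w`. -/
theorem hasFDerivAt_slabWeight (R Z : ℝ) (x : E3) : HasFDerivAt (slabWeight R Z) (slabWeight' R Z x) x := by
  have h1 := hasFDerivAt_cutoff R x
  have h2 : HasFDerivAt (fun y => vertCut Z y ^ 2)
      ((2 * vertCut Z x) • (vertCutCoeff Z x • (EuclideanSpace.proj (2 : Fin 3) : E3 →L[ℝ] ℝ))) x := by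
    have := (hasFDerivAt_vertCut Z x).pow 2
    simpa using this
  have h3 : HasFDerivAt (slabWeight R Z)
      (cutoff R x • ((2 * vertCut Z x) • (vertCutCoeff Z x • (EuclideanSpace.proj (2 : Fin 3) : E3 →L[ℝ] ℝ))) +
        vertCut Z x ^ 2 • (cutoffCoeff R x • innerSL ℝ x)) x := h1.mul h2
  exact h3

/-- `Dw(x) v` evaluated. -/
theorem fderiv_slabWeight_apply (R Z : ℝ) (x v : E3) :
    fderiv ℝ (slabWeight R Z) x v = slabWeightDeriv R Z x v := by
  rw [(hasFDerivAt_slabWeight R Z x).fderiv, slabWeight'_apply]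

/-- `w` has compact support (inside `B̄(0,2R)`, from `χ_R`). -/
theorem hasCompactSupport_slabWeight {R : ℝ} (hR : 0 < R) (Z : ℝ) : HasCompactSupport (slabWeight R Z) :=
  (hasCompactSupport_cutoff hR).mono fun x hx => by
    rw [Function.mem_support] at hx ⊢
    contrapose! hx
    simp [slabWeight, hx]

/-- The slab field `w • G_ε` is `C¹`. -/
theorem contDiff_slabField {R Z ε : ℝ} (hε : ε ≠ 0) :
    ContDiff ℝ 1 fun x => slabWeight R Z x • testField ε x :=
  (contDiff_slabWeight (n := 1) R Z).smul (contDiff_testField (n := 1) hε)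

/-- The slab field has compact support. -/
theorem hasCompactSupport_slabField {R : ℝ} (hR : 0 < R) (Z ε : ℝ) :
    HasCompactSupport fun x => slabWeight R Z x • testField ε x :=
  (hasCompactSupport_slabWeight hR Z).mono fun x hx => by
    rw [Function.mem_support] at hx ⊢
    contrapose! hx
    simp [hx]

/-- The derivative of the slab field applied to a vector. -/
theorem fderiv_slabField_apply {R Z ε : ℝ} (hε : ε ≠ 0) (x v : E3) :
    fderiv ℝ (fun y => slabWeight R Z y • testField ε y) x v =
      slabWeight R Z x • fderiv ℝ (testField ε) x v + slabWeightDeriv R Z x v • testField ε x := by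
  have h : HasFDerivAt (fun y => slabWeight R Z y • testField ε y)
      (slabWeight R Z x • testField' ε x + (slabWeight' R Z x).smulRight (testField ε x)) x :=
    (hasFDerivAt_slabWeight R Z x).smul (hasFDerivAt_testField hε x)
  rw [h.fderiv, fderiv_testField hε]
  show slabWeight R Z x • testField' ε x v + (slabWeight' R Z x v) • testField ε x = _
  rw [slabWeight'_apply]

/-- **The quadratic form of the slab field**: `⟪U, D(wG_ε)[U]⟫ = w⟪U, DG_ε[U]⟫ + Dw[U] ⟪U, G_ε⟫`. -/
theorem inner_fderiv_slabField {R Z ε : ℝ} (hε : ε ≠ 0) (U : E3 → E3) (x : E3) :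
    ⟪U x, fderiv ℝ (fun y => slabWeight R Z y • testField ε y) x (U x)⟫ =
      slabWeight R Z x * ⟪U x, fderiv ℝ (testField ε) x (U x)⟫ +
        slabWeightDeriv R Z x (U x) * ⟪U x, testField ε x⟫ := by
  rw [fderiv_slabField_apply hε, inner_add_right, inner_smul_right, inner_smul_right]

/-- `G_ε` is horizontal: `(G_ε x)₂ = 0`. -/
theorem testField_apply_two (ε : ℝ) (x : E3) : testField ε x 2 = 0 := by
  simp [testField]

/-- **The divergence of the slab field**: `div(w G_ε) = w k_ε + η_Z² c_R ρ²/(ρ²+ε²)` — the vertical cut-off contributes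
nothing because `G_ε ⊥ e₂`. -/
theorem divergence_slabField {R Z ε : ℝ} (hε : ε ≠ 0) (x : E3) :
    VectorCalculus.divergence (fun y => slabWeight R Z y • testField ε y) x =
      slabWeight R Z x * (2 * ε ^ 2 / (cylSq x + ε ^ 2) ^ 2) +
        vertCut Z x ^ 2 * cutoffCoeff R x * (cylSq x / (cylSq x + ε ^ 2)) := by
  have hw : DifferentiableAt ℝ (slabWeight R Z) x := (hasFDerivAt_slabWeight R Z x).differentiableAt
  have hG : DifferentiableAt ℝ (testField ε) x := (hasFDerivAt_testField hε x).differentiableAt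
  rw [divergence_smul_apply hw hG, divergence_testField hε, real_inner_comm, gradient,
    InnerProductSpace.toDual_symm_apply, fderiv_slabWeight_apply, slabWeightDeriv, inner_self_testField,
    testField_apply_two]
  ring

end JiuXin

end Summit.NavierStokesRegularity.NavierStokesRegularity.Theorems.PoloidalLiouville.SilentShells

end
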